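import Literature.AlgebraicGeometry.Motives.GAGA
import Literature.NumberTheory.Transcendental.ProjectiveSpaceProofs
import HarnessLib

/-!
# The analytic bridge between `ℙⁿ(ℂ)` and affine cones (proof)

Family `hodge`, layer `Literature/AlgebraicGeometry/Motives`. Proof file for the named fact
`Literature.AlgebraicGeometry.Motives.isAnalyticSetOn_conePreimage_iff` of `GAGA.lean` — the
*elementary* analytic part of the bridge between closed analytic subsets `Z ⊆ ℙⁿ(ℂ)` and their
affine cones `C(Z) = {0} ∪ π⁻¹(Z) ⊆ ℂⁿ⁺¹` (Griffiths–Harris p. 167; Mumford, *Complex Projective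
Varieties* §4B; Chirka §7.1): `C(Z)` is analytic near every point of `ℂⁿ⁺¹ ∖ {0}` iff `Z` is an
analytic subset of `ℙⁿ(ℂ)`. It is **discharged here** (`isAnalyticSetOn_conePreimage_iff_holds`),
so that the projective form of Chow's theorem (`isProjAlgebraicSet_of_isAnalyticSet`, hodge.S17)
follows from its cone form alone (`exists_finset_isHomogeneous_of_isCone`, `ChowTheorem.lean`):
`isProjAlgebraicSet_of_isAnalyticSet_of_cone_form isAnalyticSetOn_conePreimage_iff_holds`, recorded
as `isProjAlgebraicSet_of_isAnalyticSet_of_cone_form'`.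

## Proof

`ℙⁿ(ℂ) = ℙ ℂ ℂⁿ⁺¹` carries the standard atlas of `Literature/NumberTheory/Transcendental/ProjectiveSpace`
(charts `stdChart i : Uᵢ = {zᵢ ≠ 0} → ℂⁿ`, `[z] ↦ (z_{i.succAbove j} / zᵢ)ⱼ`, a holomorphic atlas by
`isManifold_projectivization_holds`).

* `→` (`isAnalyticSet_of_isAnalyticSetOn_conePreimage`): at `p ∈ Uᵢ` read `Z` through the
  holomorphic section `σᵢ : w ↦ (w₀, …, 1, …, w_{n-1})` of the projection over the chart `Uᵢ`:
  local equations `f = 0` of `C(Z)` near the nonzero vector `σᵢ(φᵢ p)` pull back to the local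
  equations `f ∘ σᵢ ∘ φᵢ = 0` of `Z` near `p` (`[σᵢ(φᵢ q)] = q` on `Uᵢ`).
* `←` (`isAnalyticSetOn_conePreimage_of_isAnalyticSet`): the projection `π : ℂⁿ⁺¹ ∖ {0} → ℙⁿ(ℂ)` is holomorphic
  (in the chart `U_{i₀} ∋ [z]` it is `z ↦ (z_{i₀.succAbove j}/z_{i₀})ⱼ`),
  so local equations `F = 0` of `Z` near `[v]` pull back to local equations `F ∘ π = 0` of `C(Z)`
  near `v ≠ 0` (`v ∈ C(Z) ↔ [v] ∈ Z`).

No closedness hypothesis is involved: both predicates are pointwise-local at the points considered.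

## References

* [GriffithsHarris1978] P. Griffiths, J. Harris, *Principles of Algebraic Geometry*, p. 167
  (Chow's theorem via the cone).
* D. Mumford, *Algebraic Geometry I: Complex Projective Varieties*, §4B; E. M. Chirka, *Complex
  Analytic Sets*, §7.1.
-/

noncomputable section

open scoped Manifold ContDiff Topology LinearAlgebra.Projectivization
open Set Projectivization
open Literature.Geometry.Kaehler (IsAnalyticSet IsAnalyticSetAt IsAnalyticSetOn)

namespace Literature.AlgebraicGeometry.Motives

section Hodge

variable {n : ℕ}

/-! ### `←`: the cone over an analytic subset is analytic off the vertex -/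

/-- **The affine cone over an analytic subset of `ℙⁿ(ℂ)` is analytic off the vertex**: local
equations `F = 0` of `Z` near `[v]` pull back along the projection `π : z ↦ [z]` to local
equations `F ∘ π = 0` of `C(Z)` near `v ≠ 0` (`v ∈ C(Z) ↔ [v] ∈ Z`). The projection (made total by
a junk value at `z = 0`, never used) is holomorphic on `{z ≠ 0}`: in the standard chart
`U_{i₀} ∋ [z]` it reads `z' ↦ (z'_{i₀.succAbove j} / z'_{i₀})ⱼ`, a quotient of coordinates by a
nonvanishing one. [Griffiths–Harris, p. 167; Mumford, *Complex Projective Varieties* §4B]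
[cite: GriffithsHarris1978, p. 167] -/
theorem isAnalyticSetOn_conePreimage_of_isAnalyticSet {Z : Set (ℙ ℂ (Fin (n + 1) → ℂ))}
    (hZ : IsAnalyticSet 𝓘(ℂ, Fin n → ℂ) Z) :
    IsAnalyticSetOn 𝓘(ℂ, Fin (n + 1) → ℂ) (conePreimage Z : Set (Fin (n + 1) → ℂ)) {0}ᶜ := by
  classical
  -- the projection `π : ℂⁿ⁺¹ → ℙⁿ(ℂ)` as a total map (junk value `[1 : 0 : ⋯ : 0]` at `z = 0`)
  obtain ⟨π, hπdef⟩ : ∃ π : (Fin (n + 1) → ℂ) → ℙ ℂ (Fin (n + 1) → ℂ), π = fun z ↦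
      if h : z = 0 then Projectivization.mk ℂ (Fin.insertNth 0 1 0) (insertNth_one_ne_zero 0 0)
      else Projectivization.mk ℂ z h := ⟨_, rfl⟩
  have hπ : ∀ {z : Fin (n + 1) → ℂ} (hz : z ≠ 0), π z = Projectivization.mk ℂ z hz := by
    intro z hz
    rw [hπdef]
    exact dif_neg hz
  have hO0 : IsOpen {z : Fin (n + 1) → ℂ | z ≠ 0} := isOpen_ne
  -- `π` is continuous on `{z ≠ 0}` (it factors through the quotient map `{v // v ≠ 0} → ℙⁿ`)
  have hπcont : ContinuousOn π {z | z ≠ 0} := by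
    rw [continuousOn_iff_continuous_restrict]
    have : ({z : Fin (n + 1) → ℂ | z ≠ 0}.restrict π) =
        fun v : {z : Fin (n + 1) → ℂ // z ≠ 0} ↦ Projectivization.mk ℂ v.1 v.2 :=
      funext fun v ↦ hπ v.2
    rw [this]
    exact continuous_mk
  -- `π` is holomorphic on `{z ≠ 0}`
  have hπdiff : ∀ {z : Fin (n + 1) → ℂ}, z ≠ 0 →
      MDifferentiableAt 𝓘(ℂ, Fin (n + 1) → ℂ) 𝓘(ℂ, Fin n → ℂ) π z := by
    intro z hz
    rw [mdifferentiableAt_iff]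
    refine ⟨hπcont.continuousAt (hO0.mem_nhds hz), ?_⟩
    -- the chart at `[z]` is `stdChart i₀` with `zᵢ₀ ≠ 0`
    set i₀ := Classical.choose (exists_rep_apply_ne_zero (π z)) with hi₀
    have hi₀' : (π z).rep i₀ ≠ 0 := Classical.choose_spec (exists_rep_apply_ne_zero _)
    have hzi₀ : z i₀ ≠ 0 := by
      have : π z ∈ stdChartSource i₀ := hi₀'
      rwa [hπ hz, mk_mem_stdChartSource_iff] at this
    simp only [writtenInExtChartAt, extChartAt, OpenPartialHomeomorph.extend,
      modelWithCornersSelf_partialEquiv, PartialEquiv.trans_refl, modelWithCornersSelf_coe,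
      Set.range_id, OpenPartialHomeomorph.toFun_eq_coe, chartAt_self_eq,
      OpenPartialHomeomorph.refl_partialEquiv, PartialEquiv.refl_coe, PartialEquiv.refl_symm,
      Function.comp_id, differentiableWithinAt_univ, chartAt_eq, ← hi₀]
    -- near `z` the written map is the rational map `z' ↦ (z'_{i₀.succAbove j} / z'_{i₀})ⱼ`
    have hev : (fun z' : Fin (n + 1) → ℂ ↦ stdChartFun i₀ (π z')) =ᶠ[𝓝 z]
        fun z' j ↦ z' (i₀.succAbove j) / z' i₀ := by
      filter_upwards [hO0.mem_nhds hz] with z' hz'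
      rw [hπ hz', stdChartFun_mk]
    refine DifferentiableAt.congr_of_eventuallyEq ?_ hev
    simp only [div_eq_mul_inv]
    refine differentiableAt_pi.2 fun j ↦ ?_
    have h1 : DifferentiableAt ℂ (fun z' : Fin (n + 1) → ℂ ↦ z' (i₀.succAbove j)) z :=
      differentiableAt_apply (i₀.succAbove j) z
    have h2 : DifferentiableAt ℂ (fun z' : Fin (n + 1) → ℂ ↦ z' i₀) z :=
      differentiableAt_apply i₀ z
    exact h1.mul (h2.inv hzi₀)
  -- pull the local equations of `Z` near `[v]` back along `π`
  intro v hv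
  replace hv : v ≠ 0 := hv
  obtain ⟨U, hU, hvU, m, F, hF, hZU⟩ := hZ (Projectivization.mk ℂ v hv)
  have hO : IsOpen ({z : Fin (n + 1) → ℂ | z ≠ 0} ∩ π ⁻¹' U) :=
    hπcont.isOpen_inter_preimage hO0 hU
  refine ⟨{z | z ≠ 0} ∩ π ⁻¹' U, hO, ⟨hv, by rwa [mem_preimage, hπ hv]⟩, m, F ∘ π, ?_, ?_⟩
  · intro z hz
    exact (hF _ hz.2).comp z (hπdiff hz.1).mdifferentiableWithinAt fun z' hz' ↦ hz'.2
  · ext z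
    simp only [mem_inter_iff, mem_setOf_eq, mem_preimage, Function.comp_apply]
    constructor
    · rintro ⟨hzC, hz0, hzU⟩
      refine ⟨⟨hz0, hzU⟩, ?_⟩
      have hzZ : π z ∈ Z := by
        rw [hπ hz0]
        exact (mem_conePreimage_iff hz0).1 hzC
      exact (hZU.subset ⟨hzZ, hzU⟩).2
    · rintro ⟨⟨hz0, hzU⟩, hFz⟩
      refine ⟨?_, hz0, hzU⟩
      rw [mem_conePreimage_iff hz0, ← hπ hz0]
      exact (hZU.symm.subset ⟨hzU, hFz⟩).1

/-! ### `→`: analyticity of the cone off the vertex descends to `ℙⁿ(ℂ)` -/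

/-- The section `σᵢ : w ↦ (w₀, …, 1, …, w_{n-1})` of the projection over the chart `Uᵢ` is
differentiable. [Griffiths–Harris, p. 15] [folklore] -/
theorem differentiable_insertNth_one (i : Fin (n + 1)) :
    Differentiable ℂ fun w : Fin n → ℂ ↦ (Fin.insertNth i (1 : ℂ) w : Fin (n + 1) → ℂ) :=
  differentiable_pi.2 fun m ↦ (contDiff_insertNth_one_apply i m).differentiable (by simp)

/-- **Analyticity of the cone off the vertex descends to `ℙⁿ(ℂ)`**: at `p ∈ Uᵢ`, local equations
`f = 0` of `C(Z)` near the nonzero vector `σᵢ(φᵢ p)` give the local equations `f ∘ σᵢ ∘ φᵢ = 0`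
of `Z` near `p`, since `[σᵢ(φᵢ q)] = q` on `Uᵢ` and `σᵢ(φᵢ q) ∈ C(Z) ↔ q ∈ Z`. Uses the holomorphic
atlas of `ℙⁿ(ℂ)` (`isManifold_projectivization_holds`) for the holomorphy of the chart `φᵢ`.
[Griffiths–Harris, p. 167; Mumford, *Complex Projective Varieties* §4B]
[cite: GriffithsHarris1978, p. 167] -/
theorem isAnalyticSet_of_isAnalyticSetOn_conePreimage {Z : Set (ℙ ℂ (Fin (n + 1) → ℂ))}
    (hC : IsAnalyticSetOn 𝓘(ℂ, Fin (n + 1) → ℂ) (conePreimage Z : Set (Fin (n + 1) → ℂ)) {0}ᶜ) :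
    IsAnalyticSet 𝓘(ℂ, Fin n → ℂ) Z := by
  haveI : IsManifold 𝓘(ℂ, Fin n → ℂ) ω (ℙ ℂ (Fin (n + 1) → ℂ)) :=
    Literature.NumberTheory.Transcendental.isManifold_projectivization_holds ℂ n
  haveI : IsManifold 𝓘(ℂ, Fin n → ℂ) 1 (ℙ ℂ (Fin (n + 1) → ℂ)) := inferInstance
  intro p
  obtain ⟨i, hi⟩ := exists_rep_apply_ne_zero p
  have hpU : p ∈ stdChartSource i := hi
  -- the nonzero vector `σᵢ(φᵢ p)` over `p` and local equations of `C(Z)` there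
  set σ : (Fin n → ℂ) → Fin (n + 1) → ℂ := fun w ↦ Fin.insertNth i (1 : ℂ) w with hσ
  have hσ0 : ∀ w, σ w ≠ 0 := fun w ↦ insertNth_one_ne_zero i w
  obtain ⟨U', hU', hvU', m, f, hf, hCU'⟩ := hC (σ (stdChartFun i p)) (hσ0 _)
  -- the open set `Uᵢ ∩ (σ ∘ φᵢ)⁻¹ U'` and the equations `f ∘ σ ∘ φᵢ`
  have hcont : ContinuousOn (fun q ↦ σ (stdChartFun i q)) (stdChartSource i) :=
    (differentiable_insertNth_one i).continuous.comp_continuousOn (continuousOn_stdChartFun i)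
  have hO : IsOpen (stdChartSource i ∩ (fun q ↦ σ (stdChartFun i q)) ⁻¹' U') :=
    hcont.isOpen_inter_preimage (isOpen_stdChartSource i) hU'
  refine ⟨stdChartSource i ∩ (fun q ↦ σ (stdChartFun i q)) ⁻¹' U', hO, ⟨hpU, hvU'⟩, m,
    fun q ↦ f (σ (stdChartFun i q)), ?_, ?_⟩
  · -- holomorphy: `f` (between model spaces), `σ` (differentiable) and the chart `φᵢ`
    have hchart : MDifferentiableOn 𝓘(ℂ, Fin n → ℂ) 𝓘(ℂ, Fin n → ℂ)
        (stdChartFun i : ℙ ℂ (Fin (n + 1) → ℂ) → Fin n → ℂ) (stdChartSource i) :=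
      mdifferentiableOn_atlas (I := 𝓘(ℂ, Fin n → ℂ)) (M := ℙ ℂ (Fin (n + 1) → ℂ)) ⟨i, rfl⟩
    have hfσ : MDifferentiableOn 𝓘(ℂ, Fin n → ℂ) 𝓘(ℂ, Fin m → ℂ) (fun w ↦ f (σ w)) (σ ⁻¹' U') := by
      rw [mdifferentiableOn_iff_differentiableOn]
      exact (mdifferentiableOn_iff_differentiableOn.1 hf).comp
        (differentiable_insertNth_one i).differentiableOn fun w hw ↦ hw
    exact hfσ.comp (hchart.mono inter_subset_left) fun q hq ↦ hq.2
  · ext q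
    simp only [mem_inter_iff, mem_preimage, mem_singleton_iff]
    constructor
    · rintro ⟨hqZ, hqU, hqU'⟩
      refine ⟨⟨hqU, hqU'⟩, ?_⟩
      have hmem : σ (stdChartFun i q) ∈ conePreimage Z := by
        rw [mem_conePreimage_iff (hσ0 _)]
        change stdChartInv i (stdChartFun i q) ∈ Z
        rwa [stdChartInv_stdChartFun i hqU]
      exact (hCU'.subset ⟨hmem, hqU'⟩).2
    · rintro ⟨⟨hqU, hqU'⟩, hfq⟩
      refine ⟨?_, hqU, hqU'⟩
      have hmem : σ (stdChartFun i q) ∈ conePreimage Z := (hCU'.symm.subset ⟨hqU', hfq⟩).1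
      rw [mem_conePreimage_iff (hσ0 _)] at hmem
      change stdChartInv i (stdChartFun i q) ∈ Z at hmem
      rwa [stdChartInv_stdChartFun i hqU] at hmem

/-! ### The discharge and Chow's theorem from the cone form -/

/-- **Discharge of `isAnalyticSetOn_conePreimage_iff`** (Griffiths–Harris p. 167; Mumford,
*Complex Projective Varieties* §4B; Chirka §7.1): the affine cone `C(Z)` is analytic near every
point of `ℂⁿ⁺¹ ∖ {0}` iff `Z` is an analytic subset of `ℙⁿ(ℂ)`
(`isAnalyticSet_of_isAnalyticSetOn_conePreimage`, `isAnalyticSetOn_conePreimage_of_isAnalyticSet`).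
[cite: GriffithsHarris1978, p. 167] -/
theorem isAnalyticSetOn_conePreimage_iff_holds : isAnalyticSetOn_conePreimage_iff (n := n) :=
  fun _ ↦ ⟨isAnalyticSet_of_isAnalyticSetOn_conePreimage, isAnalyticSetOn_conePreimage_of_isAnalyticSet⟩

/-- **hodge.S17, projective form from the cone form alone.** With the bridge proved, every closed
analytic subset of `ℙⁿ(ℂ)` is projective algebraic as soon as the cone form of Chow's theorem
(`exists_finset_isHomogeneous_of_isCone`, a named fact: Remmert–Stein at the vertex) holds in
dimension `n + 1` (`isProjAlgebraicSet_of_isAnalyticSet_of_cone_form` with its `bridge`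
hypothesis discharged). [cite: GAGA1956, §3 Prop. 13] [cite: GriffithsHarris1978, p. 167] -/
theorem isProjAlgebraicSet_of_isAnalyticSet_of_cone_form'
    (cone_form : exists_finset_isHomogeneous_of_isCone (n := n)) :
    isProjAlgebraicSet_of_isAnalyticSet (n := n) :=
  fun hZc hZ ↦ isProjAlgebraicSet_of_isAnalyticSet_of_cone_form
    isAnalyticSetOn_conePreimage_iff_holds cone_form hZc hZ

end Hodge

end Literature.AlgebraicGeometry.Motives

end
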